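import Summits.CriticalPhenomena.CardyFormulaZ2.Theorems.CardySusyWardParafermionPrecompactTouchProfileBoxHarnack
import Literature.Probability.LatticeModels.KilledWalkHarnack
import Literature.Probability.LatticeModels.KilledWalkHubFactorisation
import HarnessLib

/-!
# Two-sided Harnack on the hub box and the lower factorisation bound
(line `symplectic-fermion-anchor`, crux `SAWLoopFugacityFlow.AvoidanceLimit`,
stmt-CriticalPhenomena-10649; stub `hub_twoSided`)

For the edge-killed walk `Gr` (the walk on `ℤ²` along the edges of `Gr`, killed at its first
non-`Gr` step) in a finite region `Λ`, a hub centre `z` and a scale `k ≥ 1` such that the double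
box `mW z (2k)` (sup-radius `96k`) lies in `Λ` and is clean (all four lattice edges at each of its
sites are `Gr`-edges), the exit kernel `P_Λ(·,x) = killedPoisson Gr Λ · x` satisfies

* the **two-sided Harnack inequality on the hub** `mB z k` (sup-radius `12k`):
  `(c_*/2) P_Λ(w,x) ≤ P_Λ(z,x)` and `(c_*/2) P_Λ(z,x) ≤ P_Λ(w,x)` for `w ∈ mB z k` — the interior
  Harnack inequality `harnack_box_killed` in the clean boxes `mW z k` and `mW w k`, both contained
  in `mW z (2k)`;
* the **lower half of Chelkak's factorisation** through the hub:
  `(c_*/2) · hitProb_{mB z k}(u) · P_Λ(z,x) ≤ P_Λ(u,x)` for every `u` — first hit the hub, then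
  exit at `x` (`mul_hitProb_le_killedPoisson` with the Harnack lower bound on the hub).

Here `c_* = maneuverConst`. Everything is proved from `KilledWalkHarnack.lean`,
`KilledWalkHubFactorisation.lean` and the box bookkeeping (`mW_mono`, `mW_subset_mW_two_mul`,
`mem_mB_comm`) of `CardySusyWardParafermionPrecompactTouchProfileBoxHarnack.lean`; no definitions.
Sources: D. Chelkak, *Robust discrete complex analysis: a toolbox*, Ann. Probab. 44 (2016),
Proposition 2.7 (Harnack) and Proposition 3.1 (factorisation) [Chelkak2016];
G. F. Lawler, V. Limic, *Random Walk: A Modern Introduction* (2010), Thm. 6.3.9 [LawlerLimic2010].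
-/

noncomputable section

open scoped Classical
open Literature.Probability.LatticeModels
open Summit.CriticalPhenomena.CardyFormulaZ2.Cruxes.ParafermionPrecompact.KenyonStreamSecondRelation
  (mW_mono mW_subset_mW_two_mul mem_mB_comm)

namespace Summit.CriticalPhenomena.SAWScalingLimit.Theorems.AvoidanceLimit.Anchor

/-- **Two-sided Harnack on the hub and the lower factorisation bound.** For the edge-killed walk
`Gr` in the finite region `Λ`, a centre `z` and `k ≥ 1` with the double box `mW z (2k) ⊆ Λ` clean:
for every exit point `x`,
(i) `(c_*/2) · hitProb_{mB z k}(u) · P_Λ(z,x) ≤ P_Λ(u,x)` for all `u`, and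
(ii) `(c_*/2) P_Λ(w,x) ≤ P_Λ(z,x)` and `(c_*/2) P_Λ(z,x) ≤ P_Λ(w,x)` for all `w ∈ mB z k`.
Proof: `P_Λ(·,x)` is nonnegative and killed-harmonic on `Λ ⊇ mW z (2k) ⊇ mW z k, mW w k`, so
`harnack_box_killed` in the clean boxes `mW w k` (at `z ∈ mB w k`) and `mW z k` (at `w ∈ mB z k`)
gives (ii); then `mul_hitProb_le_killedPoisson` with `ℓ = (c_*/2) P_Λ(z,x) ≤ P_Λ(·,x)` on the hub
gives (i). [cite: Chelkak2016, Proposition 2.7, Proposition 3.1] -/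
theorem hub_twoSided :
    ∀ (Gr : SimpleGraph (Site 2)) (Λ : Set (Site 2)), Λ.Finite → ∀ (z : Site 2) (k : ℕ), 0 < k →
      mW z (2 * k) ⊆ Λ → (∀ w ∈ mW z (2 * k), ∀ e : SRW.Dir 2, Gr.Adj w (w + SRW.stepVec e)) →
      ∀ x : Site 2,
        (∀ u : Site 2, maneuverConst / 2 * (hitProb Gr Λ (mB z k) u * killedPoisson Gr Λ z x) ≤
          killedPoisson Gr Λ u x) ∧
        (∀ w ∈ mB z k, maneuverConst / 2 * killedPoisson Gr Λ w x ≤ killedPoisson Gr Λ z x ∧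
          maneuverConst / 2 * killedPoisson Gr Λ z x ≤ killedPoisson Gr Λ w x) := by
  intro Gr Λ hΛ z k hk hWΛ hclean x
  -- the exit kernel `P_Λ(·,x)` is nonnegative and killed-harmonic on `Λ`
  have hh : IsKilledHarmonicOn Gr (fun v => killedPoisson Gr Λ v x) Λ := killedPoisson_harmonicOn hΛ x
  have hpos : ∀ w, 0 ≤ (fun v => killedPoisson Gr Λ v x) w := fun w => killedPoisson_nonneg hΛ w x
  -- (ii) two-sided Harnack on the hub
  have hii : ∀ w ∈ mB z k, maneuverConst / 2 * killedPoisson Gr Λ w x ≤ killedPoisson Gr Λ z x ∧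
      maneuverConst / 2 * killedPoisson Gr Λ z x ≤ killedPoisson Gr Λ w x := by
    intro w hw
    have hsubw : mW w k ⊆ mW z (2 * k) := mW_subset_mW_two_mul hw
    have hsubz : mW z k ⊆ mW z (2 * k) := mW_mono z (by omega)
    constructor
    · -- Harnack in the clean box `mW w k` at the point `z ∈ mB w k`
      exact harnack_box_killed w hk (fun v hv e => hclean v (hsubw hv) e) (hh.mono (hsubw.trans hWΛ)) hpos
        (mem_mB_comm hw)
    · -- Harnack in the clean box `mW z k` at the point `w ∈ mB z k`
      exact harnack_box_killed z hk (fun v hv e => hclean v (hsubz hv) e) (hh.mono (hsubz.trans hWΛ)) hpos hw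
  refine ⟨fun u => ?_, hii⟩
  -- (i) first hit the hub, then exit at `x`
  have key := mul_hitProb_le_killedPoisson (Gr := Gr) (B := mB z k) hΛ (x := x)
    (ℓ := maneuverConst / 2 * killedPoisson Gr Λ z x) (fun w hw => (hii w hw).2) u
  calc maneuverConst / 2 * (hitProb Gr Λ (mB z k) u * killedPoisson Gr Λ z x)
      = maneuverConst / 2 * killedPoisson Gr Λ z x * hitProb Gr Λ (mB z k) u := by ring
    _ ≤ killedPoisson Gr Λ u x := key

end Summit.CriticalPhenomena.SAWScalingLimit.Theorems.AvoidanceLimit.Anchor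

end
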